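import Literature.MathematicalPhysics.QuantumFieldTheory.Balaban1983to89.B13ExpansionOrder

/-!
# `Balaban1983to89.B13Lemma2LeadingParts` — T. Bałaban, *Renormalization group approach to lattice gauge field theories. II.
Cluster expansions*, Commun. Math. Phys. **116** (1988) 1–22 [Balaban1988RG2Cluster], Lemma 2 pp. 10–11 ((1.34) p. 9, (1.36),
(1.39) p. 10, (1.41)–(1.43) p. 11), with [Balaban1987RG1] (2.8)–(2.13) pp. 266–268: HOW LEMMA 2's SENTENCE — the term of the
effective action localized in `Y` is *«an analytic function … of B′ in the domain {B′ : e^{16κ₁}|B′| ≤ a₁ on Y}»* with the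
cubic bound (1.39), the older terms analytic and bounded ((1.36)), the Wilson remainder *«of at least third order»* ([I] (2.8))
— BECOMES the LOCAL growth letters consumed by `B13Bound226CentredUnscaled` §4∕§5 and `B13Term214WindowDilatedUnscaled` (and
recorded by the W1 definer's `LocalGrowthInputs`): the cubic part `𝒲₃ := homPart 𝒲ᶜ 3`, the differential `D𝒪 := homPart
(𝒪ᶜ − 𝒪ᶜ(0)) 1`, their homogeneities under REAL dilations, their measurability, and the letters (L1) `‖𝒲 A‖ ≤ (M/R³)‖A‖³`,
(ℓ1) `‖𝒲 A‖ ≤ (M/R³)‖A‖Σ_{b∈S}A_b²`, (L2) `‖𝒲 − 𝒲₃‖ ≤ (2M/R⁴)‖A‖⁴` on `‖A‖ ≤ ρ < R`, (L3) `‖𝒲₃ A‖ ≤ (M/R³)‖A‖³` GLOBAL,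
(L0) `‖𝒪(0)‖ ≤ M₀`, (L4) `‖𝒪 A − 𝒪 0‖ ≤ (2M₀/R)‖A‖`, (L5) `‖𝒪 A − 𝒪 0 − D𝒪 A‖ ≤ (4M₀/R²)‖A‖²`, (L6) `‖D𝒪 A‖ ≤ (2M₀/R)‖A‖`,
from the tree's order-of-vanishing engine `B13ExpansionOrder` (`homPart`, `rem`, `BeginsAt`, Cauchy bounds along complex lines)
plus three pieces of glue: the order-`n` part is `n`-HOMOGENEOUS for every `n` (the tree had `n = 2`), the REAL SLICE
`ofRealVec : (Λ → ℝ) → (Λ → ℂ)` with its letters, and (ℓ1) ⇐ (L1) + `Y`-locality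

statement-level skeleton of published theorems with citation tags; proofs where landed; nothing here is a claim about the
Yang–Mills mass gap

PDF held: `paper:balaban1988-cmp116-rg-ii-cluster` (journal page = PDF page + 0), pp. 9–11 (quoted in `B13Sect1Statements`,
`B13ExpansionOrder`); `paper:balaban1987-cmp109-rg-i` p. 266.

CITATION HEADER.  [II] p. 10–11, Lemma 2: *"… an analytic function of … B′ in the domain … and |…| ≤ …"* (the displays (1.41)–
(1.43) as quoted in `B13Sect1Statements`); p. 9 (1.34), p. 10 (1.36), (1.39); [I] p. 266 (2.8): *"terms of at least third order
in H₁B′"*.  NOT PRINTED: the named cubic part and differential as separate objects (print keeps the whole analytic function);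
what is recorded is that print's analyticity + sup bound + order of vanishing GIVE the tree's letter shapes with explicit
constants.

PROVENANCE.  A PORT WITH PROVENANCE of the memo-only lens seat's sketch
`run/shared/lean/pub/pub-ymgap/ym-lens-BalabanUVNodes-transfer/lean/LensTransferSketch19.lean` (sha16 be29601c1d33bf73, namespace
`YMLens.Transfer19`, seat `ym-lens-BalabanUVNodes-transfer` g19, Card T31 «THE LEMMA-2 PRODUCER KIT» of `LENS-transfer.md` §25;
bus `run/shared/lean/pub/pub-ymgap/INBOX.md` l.≈20500: *«PORT OFFER (n10-c∕def-B13, your call, terms as Sketch14∕15∕17):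
`Lit/…/B13Lemma2LeadingParts.lean` = Sketch19 §A–§D»*): statements and proofs are the lens's, re-homed under `Literature` so that
tree files can import them (decl blocks identical modulo namespace, header, docstrings, and the two `@[simp]` attributes dropped
per the typer lint), each docstring saying so.  Cell `pub-ymgap`, seat `pub-ymgap-dag-n10-c` (g7), node N10 [B13]; consumers:
the W1 definer's constructor `LocalGrowthInputs.ofAnalytic` (demand d15, W1-12b), the unseated N09 ∕ Lemma-2 successor, this
seat's `B13Bound226CentredUnscaled` §4∕§5 and `B13Term214WindowDilatedUnscaled` §2–§4 (whose `𝒲₃, D𝒪`, homogeneity,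
measurability and (L0)–(L6)∕(ℓ1) binders these corollaries inhabit).

WHAT IS HERE (five definitions: `ofRealVec`, `wilsonR`, `cubicPart`, `olderR`, `linPart`; no structure ∕ class ∕ instance).
* §1 `homPart_smul`: `homPart f n (c • w) = c ^ n • homPart f n w` for EVERY `n` and `c ∈ ℂ` (from `tendsto_homPart` by the
  substitution `t ↦ tc`; no polarisation).
* §2 THE REAL SLICE `ofRealVec` (sup norms agree, real dilations pass through, continuity), and for `f` complex-differentiable
  and bounded by `M` on the complex sup-ball of radius `R`, beginning at order `n`, `ρ < R`: `realSlice_pow_bound`,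
  `realSlice_homPart_smul`, `realSlice_homPart_bound` (GLOBAL, by scaling into the ball), `realSlice_rem_bound`,
  `realSlice_measurable_homPart` (pointwise limit of `(k+1)ⁿ⁺¹·f(A/(k+1))`).
* §3 `norm_restrict_sq_le`, `loc_of_cubic_of_local` ((ℓ1) ⇐ (L1) + locality, SAME constant).
* §4 THE COROLLARIES IN THE ENGINES' BINDER SHAPES: `wilson_letters`, `consts_nonneg`, `wilson_loc`, `linPart_eq_fderiv`,
  `older_letters`.
HONEST SCOPE.  Folklore complex analysis + bookkeeping; no estimate of Bałaban's.  The producer's REMAINING inputs are print's: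
analyticity of `𝒲ᶜ(Y,·)`, `𝒪ᶜ(Y,·)` on the complex sup-ball of radius `R`, the sup bounds `M(Y)`, `M₀(Y)` (whose product with
the τ-radius carries the (2.19) profile), the order-3 onset `BeginsAt (𝒲ᶜ Y) 3`, `Y`-locality — hypotheses of the corollaries.
Nothing of Bałaban's kernels or potentials is constructed; N10∕N22∕N09 NOT discharged.  No `sorry`, no instance, no new named
fact (D-0026).
-/

open Metric Set Filter Topology
open Literature.MathematicalPhysics.QuantumFieldTheory.Balaban1983to89.B13ExpansionOrder
open Literature.MathematicalPhysics.QuantumFieldTheory.Balaban1983to89.B11SchwarzRemainder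

noncomputable section

namespace Literature.MathematicalPhysics.QuantumFieldTheory.Balaban1983to89.B13Lemma2LeadingParts

/-! ## §1. The order-`n` part is `n`-homogeneous, every `n` (lens Sketch19 §A) -/

section Hom

variable {E F : Type*} [NormedAddCommGroup E] [NormedSpace ℂ E] [NormedAddCommGroup F] [NormedSpace ℂ F]
  [CompleteSpace F]

/-- `t ↦ t·c` maps the punctured neighbourhood of `0` into itself (`c ≠ 0`). [cite: Balaban1988RG2Cluster, Lemma 2 (1.41)–(1.43) p.11, (1.39) p.10; Balaban1987RG1, (2.8)–(2.10) p.266] (elementary complex analysis for Lemma 2's expansion; lens Sketch19) -/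
theorem tendsto_mul_const_nhdsWithin_ne {c : ℂ} (hc : c ≠ 0) :
    Tendsto (fun t : ℂ => t * c) (𝓝[≠] (0 : ℂ)) (𝓝[≠] (0 : ℂ)) := by
  refine tendsto_nhdsWithin_of_tendsto_nhds_of_eventually_within _ ?_ ?_
  · have h : Tendsto (fun t : ℂ => id t * c) (𝓝 0) (𝓝 (0 * c)) := tendsto_id.mul_const c
    rw [zero_mul] at h
    exact h.mono_left nhdsWithin_le_nhds
  · exact eventually_nhdsWithin_of_forall fun t ht =>
      mem_compl_singleton_iff.2 (mul_ne_zero (mem_compl_singleton_iff.1 ht) hc)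

/-- **HOMOGENEITY OF THE ORDER-n PART**: `homPart f n (c•w) = cⁿ • homPart f n w` for every `c ∈ ℂ` — the order-n term of
the expansion along complex lines is an n-homogeneous function (the tree had this for `n = 2` only, through the second
derivative; here for all `n`, from `tendsto_homPart` and the substitution `t ↦ tc`). [cite: Balaban1988RG2Cluster, Lemma 2 (1.41)–(1.43) p.11, (1.39) p.10; Balaban1987RG1, (2.8)–(2.10) p.266] (elementary complex analysis for Lemma 2's expansion; lens Sketch19) -/
theorem homPart_smul {f : E → F} {R M : ℝ} {n : ℕ} (hR : 0 < R) (hf : DifferentiableOn ℂ f (ball 0 R))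
    (hM : ∀ z ∈ ball (0 : E) R, ‖f z‖ ≤ M) (hB : BeginsAt f n) (c : ℂ) (w : E) :
    homPart f n (c • w) = c ^ n • homPart f n w := by
  cases n with
  | zero => simp
  | succ m =>
    have h0 : f 0 = 0 := eq_zero_of_beginsAt_succ hB
    by_cases hc : c = 0
    · subst hc
      simp [homPart_zero_right h0]
    by_cases hw : w = 0
    · subst hw
      simp [homPart_zero_right h0]
    have hcw : c • w ≠ 0 := smul_ne_zero hc hw
    have key : ∀ t : ℂ, c ^ (m + 1) * ((t * c) ^ (m + 1))⁻¹ = (t ^ (m + 1))⁻¹ := fun t => by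
      rw [mul_pow, mul_inv, mul_left_comm, mul_inv_cancel₀ (pow_ne_zero _ hc), mul_one]
    have h := ((tendsto_homPart hR hf hM hB hw).comp (tendsto_mul_const_nhdsWithin_ne hc)).const_smul (c ^ (m + 1))
    unfold homPart
    refine leadCoeff_eq_of_tendsto (div_pos hR (norm_pos_iff.2 hcw)) (differentiableOn_slice hf hcw)
      (norm_slice_le hM hcw) (hB (c • w)) (h.congr' (Eventually.of_forall fun t => ?_))
    simp only [Function.comp_apply, slice_apply]
    rw [smul_smul, key t, mul_smul]

end Hom

/-! ## §2. The real slice of the field space and the letters on it (lens Sketch19 §B) -/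

section RealSlice

variable {Λ : Type*}

/-- The complexification of a real row-bond field: `A ↦ (b ↦ (A_b : ℂ))`. [cite: Balaban1988RG2Cluster, Lemma 2 (1.41)–(1.43) p.11, (1.39) p.10; Balaban1987RG1, (2.8)–(2.10) p.266] (elementary complex analysis for Lemma 2's expansion; lens Sketch19) -/
def ofRealVec (A : Λ → ℝ) : Λ → ℂ := fun b => (A b : ℂ)

/-- Unfolding the complexification at a bond (lens Sketch19 `ofRealVec_apply`). [cite: Balaban1988RG2Cluster, Lemma 2 p.11] (elementary API for the real slice) -/
theorem ofRealVec_apply (A : Λ → ℝ) (b : Λ) : ofRealVec A b = (A b : ℂ) := rfl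

/-- Real dilations pass through: `ofRealVec (r•A) = (r:ℂ) • ofRealVec A`. [cite: Balaban1988RG2Cluster, Lemma 2 (1.41)–(1.43) p.11, (1.39) p.10; Balaban1987RG1, (2.8)–(2.10) p.266] (elementary complex analysis for Lemma 2's expansion; lens Sketch19) -/
theorem ofRealVec_smul (r : ℝ) (A : Λ → ℝ) : ofRealVec (r • A) = (r : ℂ) • ofRealVec A := by
  funext b
  simp [ofRealVec, Complex.ofReal_mul]

/-- The complexification of the zero field is zero (lens Sketch19 `ofRealVec_zero`). [cite: Balaban1988RG2Cluster, Lemma 2 p.11] (elementary API for the real slice) -/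
theorem ofRealVec_zero : ofRealVec (0 : Λ → ℝ) = 0 := by
  funext b
  simp [ofRealVec]

/-- The complexification is continuous (hence measurable). [cite: Balaban1988RG2Cluster, Lemma 2 (1.41)–(1.43) p.11, (1.39) p.10; Balaban1987RG1, (2.8)–(2.10) p.266] (elementary complex analysis for Lemma 2's expansion; lens Sketch19) -/
theorem continuous_ofRealVec : Continuous (ofRealVec : (Λ → ℝ) → Λ → ℂ) :=
  continuous_pi fun b => Complex.continuous_ofReal.comp (continuous_apply b)

variable [Fintype Λ]

/-- Sup norms agree: `‖ofRealVec A‖ = ‖A‖`. [cite: Balaban1988RG2Cluster, Lemma 2 (1.41)–(1.43) p.11, (1.39) p.10; Balaban1987RG1, (2.8)–(2.10) p.266] (elementary complex analysis for Lemma 2's expansion; lens Sketch19) -/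
theorem norm_ofRealVec (A : Λ → ℝ) : ‖ofRealVec A‖ = ‖A‖ := by
  apply le_antisymm
  · refine (pi_norm_le_iff_of_nonneg (norm_nonneg A)).2 fun b => ?_
    rw [ofRealVec_apply, Complex.norm_real]
    exact norm_le_pi_norm A b
  · refine (pi_norm_le_iff_of_nonneg (norm_nonneg _)).2 fun b => ?_
    rw [← Complex.norm_real]
    exact norm_le_pi_norm (ofRealVec A) b

/-- The complexification vanishes iff the real field does (lens Sketch19 `ofRealVec_eq_zero`). [cite: Balaban1988RG2Cluster, Lemma 2 p.11] (elementary API for the real slice) -/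
theorem ofRealVec_eq_zero {A : Λ → ℝ} : ofRealVec A = 0 ↔ A = 0 := by
  rw [← norm_eq_zero, norm_ofRealVec, norm_eq_zero]

/-- A real field of sup norm `≤ ρ < R` lies in the complex sup-ball of radius `R`. [cite: Balaban1988RG2Cluster, Lemma 2 (1.41)–(1.43) p.11, (1.39) p.10; Balaban1987RG1, (2.8)–(2.10) p.266] (elementary complex analysis for Lemma 2's expansion; lens Sketch19) -/
theorem ofRealVec_mem_ball {A : Λ → ℝ} {ρ R : ℝ} (hA : ‖A‖ ≤ ρ) (hρR : ρ < R) :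
    ofRealVec A ∈ ball (0 : Λ → ℂ) R := by
  rw [mem_ball_zero_iff, norm_ofRealVec]
  exact hA.trans_lt hρR

variable {F : Type*} [NormedAddCommGroup F] [NormedSpace ℂ F] [CompleteSpace F]
  {f : (Λ → ℂ) → F} {R M ρ : ℝ} {n : ℕ}

/-- **BALL LETTER ON THE REAL SLICE** ((L1)∕(L4) shape): `‖f(A)‖ ≤ (M/Rⁿ)·‖A‖ⁿ` for real `A` with `‖A‖ ≤ ρ < R`. [cite: Balaban1988RG2Cluster, Lemma 2 (1.41)–(1.43) p.11, (1.39) p.10; Balaban1987RG1, (2.8)–(2.10) p.266] (elementary complex analysis for Lemma 2's expansion; lens Sketch19) -/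
theorem realSlice_pow_bound (hf : DifferentiableOn ℂ f (ball 0 R)) (hM : ∀ z ∈ ball (0 : Λ → ℂ) R, ‖f z‖ ≤ M)
    (hB : BeginsAt f n) (hρR : ρ < R) :
    ∀ A : Λ → ℝ, ‖A‖ ≤ ρ → ‖f (ofRealVec A)‖ ≤ M / R ^ n * ‖A‖ ^ n := fun A hA => by
  have h := pow_bound_of_beginsAt hf hM hB (ofRealVec A) (ofRealVec_mem_ball hA hρR)
  rwa [norm_ofRealVec] at h

/-- **REAL HOMOGENEITY** (module 46's `h𝒲₃`∕`hD𝒪` shape): `homPart f n (r•A) = (r:ℂ)ⁿ • homPart f n A`. [cite: Balaban1988RG2Cluster, Lemma 2 (1.41)–(1.43) p.11, (1.39) p.10; Balaban1987RG1, (2.8)–(2.10) p.266] (elementary complex analysis for Lemma 2's expansion; lens Sketch19) -/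
theorem realSlice_homPart_smul (hR : 0 < R) (hf : DifferentiableOn ℂ f (ball 0 R))
    (hM : ∀ z ∈ ball (0 : Λ → ℂ) R, ‖f z‖ ≤ M) (hB : BeginsAt f n) (r : ℝ) (A : Λ → ℝ) :
    homPart f n (ofRealVec (r • A)) = (r : ℂ) ^ n • homPart f n (ofRealVec A) := by
  rw [ofRealVec_smul, homPart_smul hR hf hM hB]

/-- **GLOBAL LETTER FOR THE HOMOGENEOUS PART** ((L3)∕(L6) shape, NO radius): `‖homPart f n A‖ ≤ (M/Rⁿ)·‖A‖ⁿ` for EVERY real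
`A` — the Cauchy bound on the ball transported by homogeneity (scale `A` to sup norm `R/2`). [cite: Balaban1988RG2Cluster, Lemma 2 (1.41)–(1.43) p.11, (1.39) p.10; Balaban1987RG1, (2.8)–(2.10) p.266] (elementary complex analysis for Lemma 2's expansion; lens Sketch19) -/
theorem realSlice_homPart_bound (hR : 0 < R) (hf : DifferentiableOn ℂ f (ball 0 R))
    (hM : ∀ z ∈ ball (0 : Λ → ℂ) R, ‖f z‖ ≤ M) (hB : BeginsAt f n) :
    ∀ A : Λ → ℝ, ‖homPart f n (ofRealVec A)‖ ≤ M / R ^ n * ‖A‖ ^ n := by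
  intro A
  have hM0 : 0 ≤ M := (norm_nonneg _).trans (hM 0 (mem_ball_self hR))
  by_cases hA : A = 0
  · subst hA
    cases n with
    | zero => simpa using hM 0 (mem_ball_self hR)
    | succ m =>
      rw [ofRealVec_zero, homPart_zero_right (eq_zero_of_beginsAt_succ hB)]
      simp
  · have hApos : 0 < ‖A‖ := norm_pos_iff.2 hA
    have hA0 : ‖A‖ ≠ 0 := hApos.ne'
    set r : ℝ := R / (2 * ‖A‖) with hr
    have hrpos : 0 < r := by positivity
    have hrA : r * ‖A‖ = R / 2 := by
      rw [hr]
      field_simp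
    have hmem : ofRealVec (r • A) ∈ ball (0 : Λ → ℂ) R := by
      rw [mem_ball_zero_iff, norm_ofRealVec, norm_smul, Real.norm_of_nonneg hrpos.le, hrA]
      linarith
    have h := norm_homPart_le hf hM hB hmem
    rw [realSlice_homPart_smul hR hf hM hB, norm_smul, norm_pow, Complex.norm_real, Real.norm_of_nonneg hrpos.le,
      norm_ofRealVec, norm_smul, Real.norm_of_nonneg hrpos.le] at h
    have h2 : r ^ n * ‖homPart f n (ofRealVec A)‖ ≤ r ^ n * (M / R ^ n * ‖A‖ ^ n) := by
      calc r ^ n * ‖homPart f n (ofRealVec A)‖ ≤ M * (r * ‖A‖ / R) ^ n := h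
        _ = r ^ n * (M / R ^ n * ‖A‖ ^ n) := by
            rw [div_pow, mul_pow]
            ring
    exact le_of_mul_le_mul_left h2 (pow_pos hrpos n)

/-- **REMAINDER LETTER ON THE REAL SLICE** ((L2)∕(L5) shape): `‖f A − homPart f n A‖ ≤ (2M/Rⁿ⁺¹)·‖A‖ⁿ⁺¹` for `‖A‖ ≤ ρ < R`. [cite: Balaban1988RG2Cluster, Lemma 2 (1.41)–(1.43) p.11, (1.39) p.10; Balaban1987RG1, (2.8)–(2.10) p.266] (elementary complex analysis for Lemma 2's expansion; lens Sketch19) -/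
theorem realSlice_rem_bound (hf : DifferentiableOn ℂ f (ball 0 R)) (hM : ∀ z ∈ ball (0 : Λ → ℂ) R, ‖f z‖ ≤ M)
    (hB : BeginsAt f n) (hρR : ρ < R) :
    ∀ A : Λ → ℝ, ‖A‖ ≤ ρ → ‖f (ofRealVec A) - homPart f n (ofRealVec A)‖ ≤ 2 * M / R ^ (n + 1) * ‖A‖ ^ (n + 1) :=
  fun A hA => by
  have h : ‖rem f n (ofRealVec A)‖ ≤ 2 * M / R ^ (n + 1) * ‖ofRealVec A‖ ^ (n + 1) :=
    pow_bound_rem hf hM hB (ofRealVec A) (ofRealVec_mem_ball hA hρR)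
  rwa [norm_ofRealVec] at h

/-- The approximating sequence: `((k+1)⁻¹ : ℝ)`, as complex numbers, tends to `0` through non-zero values. [cite: Balaban1988RG2Cluster, Lemma 2 (1.41)–(1.43) p.11, (1.39) p.10; Balaban1987RG1, (2.8)–(2.10) p.266] (elementary complex analysis for Lemma 2's expansion; lens Sketch19) -/
theorem tendsto_inv_succ_nhdsWithin_ne :
    Tendsto (fun k : ℕ => ((((k : ℝ) + 1)⁻¹ : ℝ) : ℂ)) atTop (𝓝[≠] (0 : ℂ)) := by
  have hu0 : Tendsto (fun k : ℕ => ((k : ℝ) + 1)⁻¹) atTop (𝓝 0) := by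
    simpa only [one_div] using tendsto_one_div_add_atTop_nhds_zero_nat (𝕜 := ℝ)
  have h1 : Tendsto (fun k : ℕ => ((((k : ℝ) + 1)⁻¹ : ℝ) : ℂ)) atTop (𝓝 0) := by
    have h := (Complex.continuous_ofReal.tendsto 0).comp hu0
    rwa [Complex.ofReal_zero] at h
  refine tendsto_nhdsWithin_of_tendsto_nhds_of_eventually_within _ h1 (Eventually.of_forall fun k => ?_)
  exact mem_compl_singleton_iff.2 (Complex.ofReal_ne_zero.2 (inv_ne_zero (by positivity)))

/-- **MEASURABILITY OF THE HOMOGENEOUS PART ON THE REAL SLICE** (module 46's `h𝒲₃m`∕`hD𝒪m` from its `h𝒲m`∕`h𝒪m`), for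
scalar-valued `f`: `A ↦ homPart f (n+1) A` is the POINTWISE LIMIT of the measurable `A ↦ (k+1)ⁿ⁺¹·f(A/(k+1))`. [cite: Balaban1988RG2Cluster, Lemma 2 (1.41)–(1.43) p.11, (1.39) p.10; Balaban1987RG1, (2.8)–(2.10) p.266] (elementary complex analysis for Lemma 2's expansion; lens Sketch19) -/
theorem realSlice_measurable_homPart {f : (Λ → ℂ) → ℂ} {R M : ℝ} {n : ℕ} (hR : 0 < R)
    (hf : DifferentiableOn ℂ f (ball 0 R)) (hM : ∀ z ∈ ball (0 : Λ → ℂ) R, ‖f z‖ ≤ M) (hB : BeginsAt f (n + 1))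
    (hfm : Measurable fun A : Λ → ℝ => f (ofRealVec A)) :
    Measurable fun A : Λ → ℝ => homPart f (n + 1) (ofRealVec A) := by
  have h0 : f 0 = 0 := eq_zero_of_beginsAt_succ hB
  refine measurable_of_tendsto_metrizable
    (f := fun (k : ℕ) (A : Λ → ℝ) => ((k : ℂ) + 1) ^ (n + 1) * f (ofRealVec (((k : ℝ) + 1)⁻¹ • A)))
    (fun k => (hfm.comp (continuous_const_smul (((k : ℝ) + 1)⁻¹)).measurable).const_mul _) ?_
  rw [tendsto_pi_nhds]
  intro A
  by_cases hA : A = 0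
  · subst hA
    simp only [smul_zero, ofRealVec_zero, h0, mul_zero, homPart_zero_right h0]
    exact tendsto_const_nhds
  · have hw : ofRealVec A ≠ 0 := fun h => hA (ofRealVec_eq_zero.1 h)
    have h2 := (tendsto_homPart hR hf hM hB hw).comp tendsto_inv_succ_nhdsWithin_ne
    refine h2.congr' (Eventually.of_forall fun k => ?_)
    simp only [Function.comp_apply, smul_eq_mul]
    rw [← ofRealVec_smul, Complex.ofReal_inv, inv_pow, inv_inv]
    push_cast
    rfl

/-! ## §3. (ℓ1) from (L1) and `Y`-locality — no kernel (lens Sketch19 §C) -/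

/-- Restricting a real field to a bond set: the squared sup norm of `A|_S` is at most `Σ_{b∈S} A_b²`. [cite: Balaban1988RG2Cluster, Lemma 2 (1.41)–(1.43) p.11, (1.39) p.10; Balaban1987RG1, (2.8)–(2.10) p.266] (elementary complex analysis for Lemma 2's expansion; lens Sketch19) -/
theorem norm_restrict_sq_le [DecidableEq Λ] (S : Finset Λ) (A : Λ → ℝ) :
    ‖(fun b => if b ∈ S then A b else 0 : Λ → ℝ)‖ ^ 2 ≤ ∑ b ∈ S, A b ^ 2 := by
  have hsum0 : 0 ≤ ∑ b ∈ S, A b ^ 2 := Finset.sum_nonneg fun b _ => sq_nonneg _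
  have hb : ∀ b, ‖(fun b => if b ∈ S then A b else 0 : Λ → ℝ) b‖ ≤ Real.sqrt (∑ b ∈ S, A b ^ 2) := fun b => by
    by_cases hb : b ∈ S
    · simp only [hb, if_true]
      rw [Real.norm_eq_abs, ← Real.sqrt_sq_eq_abs]
      exact Real.sqrt_le_sqrt (Finset.single_le_sum (fun b _ => sq_nonneg (A b)) hb)
    · simp only [hb, if_false, norm_zero]
      exact Real.sqrt_nonneg _
  have h' := (pi_norm_le_iff_of_nonneg (Real.sqrt_nonneg _)).2 hb
  calc ‖(fun b => if b ∈ S then A b else 0 : Λ → ℝ)‖ ^ 2 ≤ (Real.sqrt (∑ b ∈ S, A b ^ 2)) ^ 2 :=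
        pow_le_pow_left₀ (norm_nonneg _) h' 2
    _ = ∑ b ∈ S, A b ^ 2 := Real.sq_sqrt hsum0

/-- **(ℓ1) ⇐ (L1) + LOCALITY** (module 46's `h1loc` from its `h1` and the dependence of `𝒲(Y,·)` on the bonds of `S_Y` only —
Lemma 2's *«localized in»* `Y`): `‖𝒲 A‖ ≤ c₃‖A‖³` on the sup-ball and `𝒲 A = 𝒲 A′` whenever `A = A′` on `S` give
`‖𝒲 A‖ ≤ c₃·‖A‖·Σ_{b∈S}A_b²` on the same ball with the SAME constant (evaluate at the restriction `A|_S`, whose squared sup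
norm is at most the sum of squares over `S`). [cite: Balaban1988RG2Cluster, Lemma 2 (1.41)–(1.43) p.11, (1.39) p.10; Balaban1987RG1, (2.8)–(2.10) p.266] (elementary complex analysis for Lemma 2's expansion; lens Sketch19) -/
theorem loc_of_cubic_of_local {F' : Type*} [NormedAddCommGroup F'] {𝒲 : (Λ → ℝ) → F'} (S : Finset Λ) {ρ c₃ : ℝ}
    (hc₃ : 0 ≤ c₃) (hloc : ∀ A A' : Λ → ℝ, (∀ b ∈ S, A b = A' b) → 𝒲 A = 𝒲 A')
    (h1 : ∀ A, ‖A‖ ≤ ρ → ‖𝒲 A‖ ≤ c₃ * ‖A‖ ^ 3) :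
    ∀ A, ‖A‖ ≤ ρ → ‖𝒲 A‖ ≤ c₃ * ‖A‖ * ∑ b ∈ S, A b ^ 2 := by
  classical
  intro A hA
  set A' : Λ → ℝ := fun b => if b ∈ S then A b else 0 with hA'
  have hAA' : ∀ b ∈ S, A b = A' b := fun b hb => by simp [hA', hb]
  have hle : ∀ b, ‖A' b‖ ≤ ‖A‖ := fun b => by
    by_cases hb : b ∈ S
    · simp only [hA', hb, if_true]
      exact norm_le_pi_norm A b
    · simp only [hA', hb, if_false, norm_zero]
      exact norm_nonneg _
  have hA'le : ‖A'‖ ≤ ‖A‖ := (pi_norm_le_iff_of_nonneg (norm_nonneg A)).2 hle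
  have hsq : ‖A'‖ ^ 2 ≤ ∑ b ∈ S, A b ^ 2 := norm_restrict_sq_le S A
  calc ‖𝒲 A‖ = ‖𝒲 A'‖ := by rw [hloc A A' hAA']
    _ ≤ c₃ * ‖A'‖ ^ 3 := h1 A' (hA'le.trans hA)
    _ = c₃ * ‖A'‖ * ‖A'‖ ^ 2 := by ring
    _ ≤ c₃ * ‖A‖ * ∑ b ∈ S, A b ^ 2 :=
        mul_le_mul (mul_le_mul_of_nonneg_left hA'le hc₃) hsq (sq_nonneg _) (mul_nonneg hc₃ (norm_nonneg _))

/-! ## §4. The corollaries in the engines' binder shapes (lens Sketch19 §D) -/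

/-- The Wilson part on the real field and its CUBIC PART `𝒲₃ := homPart 𝒲ᶜ 3` restricted. [cite: Balaban1988RG2Cluster, Lemma 2 (1.41)–(1.43) p.11, (1.39) p.10; Balaban1987RG1, (2.8)–(2.10) p.266] (elementary complex analysis for Lemma 2's expansion; lens Sketch19) -/
def wilsonR (Wc : (Λ → ℂ) → ℂ) : (Λ → ℝ) → ℂ := fun A => Wc (ofRealVec A)

/-- `𝒲₃(A) := homPart 𝒲ᶜ 3 (A : complex)` — the third-order term of Lemma 2's expansion, on real fields. [cite: Balaban1988RG2Cluster, Lemma 2 (1.41)–(1.43) p.11, (1.39) p.10; Balaban1987RG1, (2.8)–(2.10) p.266] (elementary complex analysis for Lemma 2's expansion; lens Sketch19) -/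
def cubicPart (Wc : (Λ → ℂ) → ℂ) : (Λ → ℝ) → ℂ := fun A => homPart Wc 3 (ofRealVec A)

/-- **THE WILSON-PART LETTERS OF MODULE 46 ∕ W1-12 FROM LEMMA 2's ANALYTIC DATA**: for `𝒲ᶜ` complex-differentiable on the
complex sup-ball of radius `R`, bounded by `M` there, beginning at third order ([I] (2.8); [II] (1.39)), and any `0 < ρ < R`:
`h𝒲₃` (homogeneity `(r:ℂ)³`), `h1` with `c₃ = M/R³`, `h2` with `c₄ = 2M/R⁴`, `h3` with `c₃′ = M/R³` (GLOBAL), and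
`h𝒲₃m` from `h𝒲m`. [cite: Balaban1988RG2Cluster, Lemma 2 (1.41)–(1.43) p.11, (1.34) p.9, (1.39) p.10; Balaban1987RG1, (2.8)–(2.10) p.266] -/
theorem wilson_letters {Wc : (Λ → ℂ) → ℂ} {R M ρ : ℝ} (hρR : ρ < R) (hR : 0 < R)
    (hW : DifferentiableOn ℂ Wc (ball 0 R)) (hM : ∀ z ∈ ball (0 : Λ → ℂ) R, ‖Wc z‖ ≤ M) (hB : BeginsAt Wc 3) :
    (∀ (r : ℝ) (A : Λ → ℝ), cubicPart Wc (r • A) = (r : ℂ) ^ 3 * cubicPart Wc A) ∧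
    (∀ A : Λ → ℝ, ‖A‖ ≤ ρ → ‖wilsonR Wc A‖ ≤ M / R ^ 3 * ‖A‖ ^ 3) ∧
    (∀ A : Λ → ℝ, ‖A‖ ≤ ρ → ‖wilsonR Wc A - cubicPart Wc A‖ ≤ 2 * M / R ^ 4 * ‖A‖ ^ 4) ∧
    (∀ A : Λ → ℝ, ‖cubicPart Wc A‖ ≤ M / R ^ 3 * ‖A‖ ^ 3) ∧
    (Measurable (wilsonR Wc) → Measurable (cubicPart Wc)) :=
  ⟨fun r A => by
    show homPart Wc 3 (ofRealVec (r • A)) = (r : ℂ) ^ 3 * homPart Wc 3 (ofRealVec A)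
    rw [realSlice_homPart_smul hR hW hM hB, smul_eq_mul],
   realSlice_pow_bound hW hM hB hρR,
   realSlice_rem_bound hW hM hB hρR,
   realSlice_homPart_bound hR hW hM hB,
   fun hm => realSlice_measurable_homPart hR hW hM hB hm⟩

/-- `0 ≤ M/R³` etc. (module 46's `hc₃ hc₃' hc₄`): the sup bound is non-negative. [cite: Balaban1988RG2Cluster, Lemma 2 (1.41)–(1.43) p.11, (1.39) p.10; Balaban1987RG1, (2.8)–(2.10) p.266] (elementary complex analysis for Lemma 2's expansion; lens Sketch19) -/
theorem consts_nonneg {Wc : (Λ → ℂ) → ℂ} {R M : ℝ} (hR : 0 < R) (hM : ∀ z ∈ ball (0 : Λ → ℂ) R, ‖Wc z‖ ≤ M) :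
    0 ≤ M / R ^ 3 ∧ 0 ≤ 2 * M / R ^ 4 ∧ 0 ≤ M ∧ 0 ≤ 2 * M / R ∧ 0 ≤ 4 * M / R ^ 2 := by
  have hM0 : 0 ≤ M := (norm_nonneg _).trans (hM 0 (mem_ball_self hR))
  refine ⟨by positivity, by positivity, hM0, by positivity, by positivity⟩

/-- (ℓ1) for the Wilson part from `h1` and S-locality (§C at the corollary's constant). [cite: Balaban1988RG2Cluster, Lemma 2 (1.41)–(1.43) p.11, (1.39) p.10; Balaban1987RG1, (2.8)–(2.10) p.266] (elementary complex analysis for Lemma 2's expansion; lens Sketch19) -/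
theorem wilson_loc {Wc : (Λ → ℂ) → ℂ} {R M ρ : ℝ} (hρR : ρ < R) (hR : 0 < R)
    (hW : DifferentiableOn ℂ Wc (ball 0 R)) (hM : ∀ z ∈ ball (0 : Λ → ℂ) R, ‖Wc z‖ ≤ M) (hB : BeginsAt Wc 3)
    (S : Finset Λ) (hloc : ∀ A A' : Λ → ℝ, (∀ b ∈ S, A b = A' b) → wilsonR Wc A = wilsonR Wc A') :
    ∀ A : Λ → ℝ, ‖A‖ ≤ ρ → ‖wilsonR Wc A‖ ≤ M / R ^ 3 * ‖A‖ * ∑ b ∈ S, A b ^ 2 :=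
  loc_of_cubic_of_local S (consts_nonneg hR hM).1 hloc (realSlice_pow_bound hW hM hB hρR)

/-- The older terms on the real field and their DIFFERENTIAL `D𝒪 := homPart (𝒪ᶜ − 𝒪ᶜ(0)) 1` restricted. [cite: Balaban1988RG2Cluster, Lemma 2 (1.41)–(1.43) p.11, (1.39) p.10; Balaban1987RG1, (2.8)–(2.10) p.266] (elementary complex analysis for Lemma 2's expansion; lens Sketch19) -/
def olderR (Oc : (Λ → ℂ) → ℂ) : (Λ → ℝ) → ℂ := fun A => Oc (ofRealVec A)

/-- `D𝒪(A) := homPart (𝒪ᶜ − 𝒪ᶜ 0) 1 (A : complex)` — the first-order term, on real fields (= `D𝒪ᶜ(0)·A`, `linPart_eq_fderiv`). [cite: Balaban1988RG2Cluster, Lemma 2 (1.41)–(1.43) p.11, (1.39) p.10; Balaban1987RG1, (2.8)–(2.10) p.266] (elementary complex analysis for Lemma 2's expansion; lens Sketch19) -/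
def linPart (Oc : (Λ → ℂ) → ℂ) : (Λ → ℝ) → ℂ := fun A => homPart (fun z => Oc z - Oc 0) 1 (ofRealVec A)

/-- `D𝒪` IS the Fréchet differential at the zero field, restricted to real fields. [cite: Balaban1988RG2Cluster, Lemma 2 (1.41)–(1.43) p.11, (1.39) p.10; Balaban1987RG1, (2.8)–(2.10) p.266] (elementary complex analysis for Lemma 2's expansion; lens Sketch19) -/
theorem linPart_eq_fderiv {Oc : (Λ → ℂ) → ℂ} {R : ℝ} (hR : 0 < R) (hO : DifferentiableOn ℂ Oc (ball 0 R))
    (A : Λ → ℝ) : linPart Oc A = fderiv ℂ Oc 0 (ofRealVec A) := by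
  have hd : DifferentiableAt ℂ Oc 0 := hO.differentiableAt (ball_mem_nhds (0 : Λ → ℂ) hR)
  show homPart (fun z => Oc z - Oc 0) 1 (ofRealVec A) = fderiv ℂ Oc 0 (ofRealVec A)
  rw [homPart_one (hd.sub_const _), fderiv_sub_const]

/-- **THE OLDER-TERMS LETTERS OF MODULE 46 ∕ W1-12 FROM ANALYTICITY + A SUP BOUND**: for `𝒪ᶜ` complex-differentiable on
the complex sup-ball of radius `R`, bounded by `M₀` there, and any `ρ < R`: `h0` with `c₀ = M₀`, `hD𝒪` (homogeneity
`(r:ℂ)`), `h4` with `c₁ = 2M₀/R`, `h5` with `c₂ = 4M₀/R²`, `h6` with `c₁′ = 2M₀/R` (GLOBAL), `hD𝒪m` from `h𝒪m`.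
[cite: Balaban1988RG2Cluster, Lemma 2 p.11 and (1.36) p.9 (the bound on V″ and the older terms); Balaban1987RG1, (2.9)–(2.13) pp.266–268] -/
theorem older_letters {Oc : (Λ → ℂ) → ℂ} {R M₀ ρ : ℝ} (hρR : ρ < R) (hR : 0 < R)
    (hO : DifferentiableOn ℂ Oc (ball 0 R)) (hM₀ : ∀ z ∈ ball (0 : Λ → ℂ) R, ‖Oc z‖ ≤ M₀) :
    ‖olderR Oc 0‖ ≤ M₀ ∧
    (∀ (r : ℝ) (A : Λ → ℝ), linPart Oc (r • A) = (r : ℂ) * linPart Oc A) ∧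
    (∀ A : Λ → ℝ, ‖A‖ ≤ ρ → ‖olderR Oc A - olderR Oc 0‖ ≤ 2 * M₀ / R * ‖A‖) ∧
    (∀ A : Λ → ℝ, ‖A‖ ≤ ρ → ‖olderR Oc A - olderR Oc 0 - linPart Oc A‖ ≤ 4 * M₀ / R ^ 2 * ‖A‖ ^ 2) ∧
    (∀ A : Λ → ℝ, ‖linPart Oc A‖ ≤ 2 * M₀ / R * ‖A‖) ∧
    (Measurable (olderR Oc) → Measurable (linPart Oc)) := by
  -- the centred function `g := 𝒪ᶜ − 𝒪ᶜ(0)`: differentiable, bounded by `2M₀`, beginning at first order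
  set g : (Λ → ℂ) → ℂ := fun z => Oc z - Oc 0 with hg
  have hgd : DifferentiableOn ℂ g (ball 0 R) := hO.sub_const _
  have hgM : ∀ z ∈ ball (0 : Λ → ℂ) R, ‖g z‖ ≤ 2 * M₀ := fun z hz => by
    calc ‖Oc z - Oc 0‖ ≤ ‖Oc z‖ + ‖Oc 0‖ := norm_sub_le _ _
      _ ≤ M₀ + M₀ := add_le_add (hM₀ z hz) (hM₀ 0 (mem_ball_self hR))
      _ = 2 * M₀ := by ring
  have hgB : BeginsAt g 1 := beginsAt_one hR hgd (sub_self _)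
  have e0 : olderR Oc 0 = Oc 0 := by simp [olderR, ofRealVec_zero]
  have eg : ∀ A : Λ → ℝ, olderR Oc A - olderR Oc 0 = g (ofRealVec A) := fun A => by rw [e0]; rfl
  refine ⟨?_, ?_, ?_, ?_, ?_, ?_⟩
  · rw [e0]; exact hM₀ 0 (mem_ball_self hR)
  · intro r A
    show homPart g 1 (ofRealVec (r • A)) = (r : ℂ) * homPart g 1 (ofRealVec A)
    rw [realSlice_homPart_smul hR hgd hgM hgB, pow_one, smul_eq_mul]
  · intro A hA
    rw [eg]
    have h := realSlice_pow_bound hgd hgM hgB hρR A hA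
    rwa [pow_one, pow_one] at h
  · intro A hA
    rw [eg]
    have h := realSlice_rem_bound hgd hgM hgB hρR A hA
    have e : 2 * (2 * M₀) / R ^ (1 + 1) = 4 * M₀ / R ^ 2 := by ring
    rwa [e] at h
  · intro A
    have h := realSlice_homPart_bound hR hgd hgM hgB A
    rwa [pow_one, pow_one] at h
  · intro hm
    have hm' : Measurable fun A : Λ → ℝ => g (ofRealVec A) := by
      have : (fun A : Λ → ℝ => g (ofRealVec A)) = fun A => olderR Oc A - olderR Oc 0 := funext fun A => (eg A).symm
      rw [this]
      exact hm.sub_const _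
    exact realSlice_measurable_homPart hR hgd hgM hgB hm'

end RealSlice

/-! ## §5 (v1.1, append-only). Order constructors for the producer: `BeginsAt f (n+1)` from `BeginsAt f n` and the
vanishing of the order-`n` part; `BeginsAt 𝒲ᶜ 3` from `𝒲ᶜ(0) = 0`, `D𝒲ᶜ(0) = 0` and the vanishing quadratic part -/

section OrderConstructors

variable {E F : Type*} [NormedAddCommGroup E] [NormedSpace ℂ E] [NormedAddCommGroup F] [NormedSpace ℂ F]
  [CompleteSpace F]

/-- **ONE ORDER UP**: a map beginning at order `n` whose order-`n` part vanishes identically begins at order `n + 1` (the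
remainder's slices are `O(tⁿ⁺¹)`, `B13ExpansionOrder.orderGe_slice_rem`, and here the remainder IS the map) — the step by which
a producer reads *«terms of at least third order»* ([I] (2.8)) as `BeginsAt _ 3`.
[cite: Balaban1987RG1, (2.8) p.266; Balaban1988RG2Cluster, (1.39) p.10] (elementary complex analysis for Lemma 2's expansion) -/
theorem beginsAt_succ_of_homPart_eq_zero {f : E → F} {R M : ℝ} {n : ℕ} (hR : 0 < R)
    (hf : DifferentiableOn ℂ f (ball 0 R)) (hM : ∀ z ∈ ball (0 : E) R, ‖f z‖ ≤ M) (hB : BeginsAt f n)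
    (h : ∀ w, homPart f n w = 0) : BeginsAt f (n + 1) := fun w => by
  have h1 := orderGe_slice_rem hR hf hM hB w
  have h2 : OrderGe (fun t : ℂ => f (t • w)) (n + 1) := by simpa only [h w, smul_zero, sub_zero] using h1
  exact h2

/-- **`BeginsAt f 3` FROM THE VANISHING OF THE 2-JET**: `f 0 = 0`, `Df(0) = 0` (`B13ExpansionOrder.beginsAt_two`) and the
vanishing of the quadratic part `homPart f 2 ≡ 0` (for analytic `f`, `homPart f 2 w = ½·D²f(0)(w,w)` by
`B13ExpansionOrder.homPart_two_eq`) give order three — the producer's reading of [I] (2.8) *"V … terms of at least third order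
in H₁B′"* for `wilson_letters`' hypothesis `BeginsAt Wc 3`.
[cite: Balaban1987RG1, (2.8)–(2.10) pp.266–267; Balaban1988RG2Cluster, (1.39) p.10] (elementary complex analysis for Lemma 2's expansion) -/
theorem beginsAt_three {f : E → F} {R M : ℝ} (hR : 0 < R) (hf : DifferentiableOn ℂ f (ball 0 R))
    (hM : ∀ z ∈ ball (0 : E) R, ‖f z‖ ≤ M) (h0 : f 0 = 0) (h1 : fderiv ℂ f 0 = 0) (h2 : ∀ w, homPart f 2 w = 0) :
    BeginsAt f 3 :=
  beginsAt_succ_of_homPart_eq_zero hR hf hM (beginsAt_two hR hf h0 h1) h2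

end OrderConstructors

/-! ## §6 (v1.2, append-only). NON-VACUITY OF THE KIT'S HYPOTHESES: the one-bond cube and an affine older term -/

section Witness

variable {Λ : Type*} [Fintype Λ]

/-- The one-bond cubic `z ↦ (z b₀)³` is complex-differentiable everywhere (witness data). [cite: Balaban1987RG1, (2.8) p.266] (elementary witness) -/
theorem differentiable_cube (b₀ : Λ) : Differentiable ℂ (fun z : Λ → ℂ => (z b₀) ^ 3) :=
  ((ContinuousLinearMap.proj (R := ℂ) (φ := fun _ : Λ => ℂ) b₀).differentiable).pow 3

/-- Its sup bound on the complex sup-ball of radius `R`: `‖(z b₀)³‖ ≤ R³` (witness data). [cite: Balaban1987RG1, (2.8) p.266] (elementary witness) -/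
theorem cube_bound (b₀ : Λ) (R : ℝ) : ∀ z ∈ ball (0 : Λ → ℂ) R, ‖(z b₀) ^ 3‖ ≤ R ^ 3 := by
  intro z hz
  rw [norm_pow]
  exact pow_le_pow_left₀ (norm_nonneg _) ((norm_le_pi_norm z b₀).trans (mem_ball_zero_iff.1 hz).le) 3

/-- **The one-bond cube BEGINS AT ORDER THREE** (`‖((t•w) b₀)³‖ = ‖w b₀‖³‖t‖³` on every slice) — a genuinely cubic
inhabitant of `wilson_letters`' hypothesis `BeginsAt Wc 3`. [cite: Balaban1987RG1, (2.8) p.266] (elementary witness) -/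
theorem beginsAt_cube (b₀ : Λ) : BeginsAt (fun z : Λ → ℂ => (z b₀) ^ 3) 3 := fun w =>
  OrderGe.of_bound_on_ball one_pos (C := ‖w b₀‖ ^ 3) fun t _ => by
    simp only [slice_apply, Pi.smul_apply, smul_eq_mul, mul_pow, norm_mul, norm_pow]
    exact le_of_eq (mul_comm _ _)

/-- **NON-VACUITY OF `wilson_letters`**: its hypotheses (complex-differentiable on the sup-ball, bounded by `M = R³`, beginning
at order three) are met by the one-bond cube for every `0 < R`, `ρ < R`, so its five conclusions (homogeneity, (L1) with
`c₃ = R³/R³`, (L2) with `c₄ = 2R³/R⁴`, (L3), measurability transfer) hold for a non-zero cubic Wilson-type part.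
[cite: Balaban1987RG1, (2.8)–(2.10) p.266; Balaban1988RG2Cluster, (1.39) p.10] (elementary witness) -/
theorem wilson_letters_cube (b₀ : Λ) {R ρ : ℝ} (hρR : ρ < R) (hR : 0 < R) :
    (∀ (r : ℝ) (A : Λ → ℝ), cubicPart (fun z : Λ → ℂ => (z b₀) ^ 3) (r • A)
        = (r : ℂ) ^ 3 * cubicPart (fun z : Λ → ℂ => (z b₀) ^ 3) A) ∧
    (∀ A : Λ → ℝ, ‖A‖ ≤ ρ → ‖wilsonR (fun z : Λ → ℂ => (z b₀) ^ 3) A‖ ≤ R ^ 3 / R ^ 3 * ‖A‖ ^ 3) ∧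
    (∀ A : Λ → ℝ, ‖A‖ ≤ ρ → ‖wilsonR (fun z : Λ → ℂ => (z b₀) ^ 3) A - cubicPart (fun z : Λ → ℂ => (z b₀) ^ 3) A‖
        ≤ 2 * R ^ 3 / R ^ 4 * ‖A‖ ^ 4) ∧
    (∀ A : Λ → ℝ, ‖cubicPart (fun z : Λ → ℂ => (z b₀) ^ 3) A‖ ≤ R ^ 3 / R ^ 3 * ‖A‖ ^ 3) ∧
    (Measurable (wilsonR (fun z : Λ → ℂ => (z b₀) ^ 3)) → Measurable (cubicPart (fun z : Λ → ℂ => (z b₀) ^ 3))) :=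
  wilson_letters hρR hR (differentiable_cube b₀).differentiableOn (cube_bound b₀ R) (beginsAt_cube b₀)

/-- An affine older term `z ↦ c + z b₀` is complex-differentiable everywhere (witness data). [cite: Balaban1987RG1, (2.12)–(2.13) p.268] (elementary witness) -/
theorem differentiable_affine (b₀ : Λ) (c : ℂ) : Differentiable ℂ (fun z : Λ → ℂ => c + z b₀) :=
  (differentiable_const c).add (ContinuousLinearMap.proj (R := ℂ) (φ := fun _ : Λ => ℂ) b₀).differentiable

/-- Its sup bound on the complex sup-ball of radius `R`: `‖c + z b₀‖ ≤ ‖c‖ + R` (witness data). [cite: Balaban1987RG1, (2.12)–(2.13) p.268] (elementary witness) -/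
theorem affine_bound (b₀ : Λ) (c : ℂ) (R : ℝ) : ∀ z ∈ ball (0 : Λ → ℂ) R, ‖c + z b₀‖ ≤ ‖c‖ + R := fun z hz =>
  (norm_add_le _ _).trans (add_le_add le_rfl ((norm_le_pi_norm z b₀).trans (mem_ball_zero_iff.1 hz).le))

/-- **NON-VACUITY OF `older_letters`**: its hypotheses are met by the affine older term `c + z b₀` with `M₀ = ‖c‖ + R`, so
its six conclusions ((L0), homogeneity of the differential, (L4), (L5), (L6), measurability transfer) hold for a non-constant
older-terms part. [cite: Balaban1987RG1, (2.12)–(2.13) p.268; Balaban1988RG2Cluster, (1.36) p.9] (elementary witness) -/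
theorem older_letters_affine (b₀ : Λ) (c : ℂ) {R ρ : ℝ} (hρR : ρ < R) (hR : 0 < R) :
    ‖olderR (fun z : Λ → ℂ => c + z b₀) 0‖ ≤ ‖c‖ + R ∧
    (∀ (r : ℝ) (A : Λ → ℝ), linPart (fun z : Λ → ℂ => c + z b₀) (r • A)
        = (r : ℂ) * linPart (fun z : Λ → ℂ => c + z b₀) A) ∧
    (∀ A : Λ → ℝ, ‖A‖ ≤ ρ → ‖olderR (fun z : Λ → ℂ => c + z b₀) A - olderR (fun z : Λ → ℂ => c + z b₀) 0‖
        ≤ 2 * (‖c‖ + R) / R * ‖A‖) ∧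
    (∀ A : Λ → ℝ, ‖A‖ ≤ ρ → ‖olderR (fun z : Λ → ℂ => c + z b₀) A - olderR (fun z : Λ → ℂ => c + z b₀) 0
        - linPart (fun z : Λ → ℂ => c + z b₀) A‖ ≤ 4 * (‖c‖ + R) / R ^ 2 * ‖A‖ ^ 2) ∧
    (∀ A : Λ → ℝ, ‖linPart (fun z : Λ → ℂ => c + z b₀) A‖ ≤ 2 * (‖c‖ + R) / R * ‖A‖) ∧
    (Measurable (olderR (fun z : Λ → ℂ => c + z b₀)) → Measurable (linPart (fun z : Λ → ℂ => c + z b₀))) :=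
  older_letters hρR hR (differentiable_affine b₀ c).differentiableOn (affine_bound b₀ c R)

end Witness

end Literature.MathematicalPhysics.QuantumFieldTheory.Balaban1983to89.B13Lemma2LeadingParts

end
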